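import Literature.MathematicalPhysics.QuantumFieldTheory.OSPointRealData
import Literature.MathematicalPhysics.QuantumFieldTheory.OSPointSemigroup
import Literature.MathematicalPhysics.QuantumFieldTheory.OSLabelledTower
import HarnessLib

/-!
# Osterwalder–Schrader II, Theorem 4.2 for Schwinger families (analytic continuation in the times)

Topic `Literature/MathematicalPhysics/QuantumFieldTheory`; support file (all proved; no new
definitions; no named facts) for the discharge of (A1) `OS1975_exists_timeContinuation`: the
abstract continuation engine (`OSLabelledPieces` … `OSLabelledTower`, Ch. V of OS II) applied to the
data of an actual Schwinger family satisfying E0' (linear growth), E1 (Euclidean covariance) and E2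
(reflection positivity): the semigroup `e^{-τH}` (`OSPointSemigroup`), the labelled point vectors
(`OSPointLabelledVectors`) and the Schwinger function values with their pointwise Gram identity,
continuity and the bound (4.5) (`OSPointRealData`).

* `schwinger_exists_labelledTimeContinuation` — **OS II Thm. 4.2 (qualitative form with local
  label-uniform bounds)**: for every radius `R` there is a family `Sext k c` of functions,
  holomorphic on `ℂ₊ᵏ = {Re ζᵢ > 0}` for all `k ≥ 1` and all spatial labels `c` in the ball of radius
  `R`, which at the positive real points `ζ = ξ` are the Schwinger function values
  `S_{k+1}((0, c⃗₀), (ξ₀, c⃗₁), (ξ₀ + ξ₁, c⃗₂), …)` (the continuous densities of Thm. 4.1), bounded on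
  the argument regions of compact subcubes of `(−π/2, π/2)ᵏ` by `C · Π(ζ)ᵉ` uniformly in the labels,
  and satisfying the level-free Schwarz inequalities (5.17)/(5.4) of Ch. V.2.

The temperedness estimate (4.6) (`HasOSGrowth`) is `OSTemperedBound.exists_tempered_tower` once the
real bound (4.5) is available in the sum form with exponent linear in `k` (E0'); the bound of
`OSTemperedness` has a `k`-dependent exponent of higher order, so (4.6) is not derived here.

## References

* K. Osterwalder, R. Schrader, *Axioms for Euclidean Green's functions II*, Comm. Math. Phys.
  42 (1975) 281–305, §IV.2 Thms. 4.1–4.2; Ch. V, V.1, V.2. [OsterwalderSchraderCMP1975]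
-/

noncomputable section

open Set
open scoped InnerProductSpace

namespace Literature.MathematicalPhysics.QuantumFieldTheory

variable {d : ℕ} [NeZero d]

open Literature.MathematicalPhysics.QuantumLattice (SchwingerFamily)
open Literature.MathematicalPhysics.QuantumLattice.SchwingerFamily
open Literature.MathematicalPhysics.QuantumLattice.SchwingerFamily.OSSpace
open Literature.MathematicalPhysics.QuantumFieldTheory.OSEnvelope
open Literature.Analysis.Complex

/-- **Osterwalder–Schrader II, Theorem 4.2 (analytic continuation of the Schwinger functions in
the time differences), for a Schwinger family with E0', E1, E2** — qualitative form with local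
label-uniform bounds and the Schwarz inequalities of Ch. V.2: see the module docstring. [cite: OsterwalderSchraderCMP1975, §IV.2 Thm. 4.2; Ch. V.2 (5.17), Ch. V (5.4)] -/
theorem schwinger_exists_labelledTimeContinuation (𝔖 : SchwingerFamily (EuclideanSpace ℝ (Fin d)))
    (hE1 : 𝔖.IsEuclideanCovariant) (hE2 : 𝔖.IsOSReflectionPositive) (hE0 : 𝔖.HasLinearGrowth) (R : ℝ) :
    ∃ Sext : (k : ℕ) → (Fin (k + 1) → EuclideanSpace ℝ (Fin d)) → (Fin k → ℂ) → ℂ,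
      (∀ (k : ℕ) (c : Fin (k + 1) → EuclideanSpace ℝ (Fin d)), normBall R k c → 0 < k →
        DifferentiableOn ℂ (Sext k c) {Z | ∀ i, 0 < (Z i).re}) ∧
      (∀ (k : ℕ) (c : Fin (k + 1) → EuclideanSpace ℝ (Fin d)), 0 < k → ∀ ρ : Fin k → ℝ, (∀ i, 0 < ρ i) →
        Sext k c (fun i => (ρ i : ℂ)) = pointS₀ hE1 hE2 hE0 k c (fun i => (ρ i : ℂ))) ∧
      (∀ (k : ℕ) (c : Fin (k + 1) → EuclideanSpace ℝ (Fin d)), normBall R k c → 0 < k →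
        ∀ K : Set (Fin k → ℝ), IsCompact K → K ⊆ {v | ∀ i, |v i| < Real.pi / 2} →
          ∀ Z ∈ argRegion K, ‖Sext k c Z‖ ≤
            cubeConst 0 1 (zeroConst 1 (pointC₀ hE1 hE2 hE0 R) (pointp₀ hE1 hE2 hE0))
                (zeroExp (pointp₀ hE1 hE2 hE0)) k K *
              gFactor Z ^ cubeExp 0 1 (zeroConst 1 (pointC₀ hE1 hE2 hE0 R) (pointp₀ hE1 hE2 hE0))
                (zeroExp (pointp₀ hE1 hE2 hE0)) k K) ∧
      ∀ (k : ℕ) (c : Fin (k + 1) → EuclideanSpace ℝ (Fin d)), normBall R k c →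
        ∀ (p : Fin k) (Z : Fin k → ℂ), (∀ i, 0 < (Z i).re) →
          ∀ (x' x : ℝ) (τ : ℂ), 0 < x' → 0 < x → 0 ≤ τ.re → (x' : ℂ) + x + τ = Z p →
            ‖Sext k c Z‖ ≤ ‖holoShiftH (hE2 := hE2) hE1 τ‖ *
              Real.sqrt ((Sext (p + 1 + p) (dblPos (posRevLeft c p))
                (cDiagEmbed (blockRevLeft Z p) ((2 * x' : ℝ) : ℂ) (star (blockRevLeft Z p)))).re) *
              Real.sqrt ((Sext (k - 1 - p + 1 + (k - 1 - p)) (dblPos (posRight c p))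
                (cDiagEmbed (star (blockRight Z p)) ((2 * x : ℝ) : ℂ) (blockRight Z p))).re) := by
  have hT := isOSSemigroup_holoShiftH (hE2 := hE2) hE1
  have hΦ := isOSLabelledVectors_labVec (hE2 := hE2) hE1 hE0
  have hgood := isOSLabelSet_normBall (d := d) R
  have hD := isOSLabelledRealData_point hE1 hE2 hE0 R
  obtain ⟨S, hL0, hG0, hrealS⟩ := hD.exists_levelZero hT hΦ hgood
  obtain ⟨Sext, hhol, heq, hbd, hSchw⟩ := hL0.exists_tower hT hΦ hgood hG0
  refine ⟨Sext, hhol, fun k c hk ρ hρ => ?_, hbd, hSchw⟩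
  have hmem : (fun i => (ρ i : ℂ)) ∈ argRegion (osBaseC (0 + 1) k) := ofReal_mem_argRegion (zero_mem_osBaseC _ hk) hρ
  rw [heq k c hmem, hrealS k c ρ hρ]

end Literature.MathematicalPhysics.QuantumFieldTheory
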